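import Mathlib
import HarnessLib
import Summits.HubbardSuperconductivity.HubbardSuperconductivity.Theorems.KLProgrammeLocalVertexPlainCurrency

/-!
# Route `KLProgramme` — ENGINE (stmt-HubbardSuperconductivity-20437 `KLRegimeEngineV17F2`), located candidate #25 «(b)-PLAIN-UV-TAIL», cure (γ′) bricks:
# THE LOCAL VERTEX AS A MOMENTUM SUM — `V_loc = Σ_κ [κ conserving MODULO 2M]·U(βL²)⁻³ • (vertex monomial κ)`, hence `V_loc − V` = the frequency-UMKLAPP
# monomials exactly, and the two vertices have THE SAME quartic kernels at every label string away from the Matsubara edge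
# (cell gate-hubbard-kl, seat hubbard-kl-k3c2-p2 g33)

* `klbv_sum_cexp_two_pi_int` — `Σ_{j<2M} e^{−2πi·m·j/(2M)} = 2M·[2M ∣ m]` (`m ∈ ℤ`);
* `klbv_sum_prod_planeWave_vertexPattern` — the signed four-wave sum `Σ_y ∏_i e^{−is_iκ_i·y} = |Λ|·[2M ∣ (n₀−n₁+n₂−n₃) ∧ k⃗₀+k⃗₂ = k⃗₁+k⃗₃]` (`β ≠ 0`);
* **`klbv_hubbardInteractionLocal_eq_sum_smul`** — `hubbardInteractionLocal = Σ_κ [modular conservation]·U(βL²)⁻³ • vertexMonomial κ` (compare Literature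
  `hubbardInteraction_eq_sum_smul`: INTEGER conservation `vertexConserving`);
* **`klbv_hubbardInteractionLocal_sub_hubbardInteraction`** — `V_loc − V = Σ_κ [modular ∧ ¬ integer]·U(βL²)⁻³ • vertexMonomial κ` (the umklapp part);
* **`klbv_kernel_vertexLegs_local_eq_of_small`** — if `|n₀|+|n₁|+|n₂|+|n₃| < 2M` (all four legs away from the Matsubara edge, e.g. on any UV-cut sector support)
  then `kernel V_loc 4 (vertexLegs k) = kernel V 4 (vertexLegs k)`: the located defect is invisible to every SECTORISED row, and cure (γ′) (re-base on `V_loc`)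
  changes no UV-cut kernel.
Pure algebra on tree definitions; no definitions; nothing asserts any row, (b), (C), K3 or superconductivity.
References: Salmhofer 1999 §4.2.4 (4.54)–(4.63) [cite: Salmhofer1999]; BGM 2006 §2.1 (2.5)–(2.6a) [cite: BenfattoGiulianiMastropietro2006].
-/

noncomputable section

namespace Summit.HubbardSuperconductivity.HubbardSuperconductivity.Theorems.KLRegimeSplit

set_option linter.dupNamespace false -- summit = problem name (single-conjunct summit), D-0017

open Finset Literature.MathematicalPhysics.QuantumLattice Literature.Probability.LatticeModels GrassmannAlgebra
open scoped ComplexConjugate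

variable {L M : ℕ} [NeZero L] [NeZero M]

/-! ## §1 Roots of unity: `Σ_{j<2M} e^{−2πi m j/(2M)} = 2M·[2M ∣ m]` -/

omit [NeZero L] in
/-- `Σ_{j : Fin (2M)} exp(−2πi·m·j/(2M)) = 2M` if `2M ∣ m`, else `0`. -/
theorem klbv_sum_cexp_two_pi_int (m : ℤ) :
    ∑ j : ImagTimeIdx M, Complex.exp (-((2 * Real.pi * (m : ℝ) * ((j : ℕ) : ℝ) / (2 * M) : ℝ) : ℂ) * Complex.I) =
      if ((2 * M : ℕ) : ℤ) ∣ m then ((2 * M : ℕ) : ℂ) else 0 := by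
  have hMpos : 0 < 2 * M := by have := NeZero.ne M; omega
  have hterm : ∀ j : ImagTimeIdx M, Complex.exp (-((2 * Real.pi * (m : ℝ) * ((j : ℕ) : ℝ) / (2 * M) : ℝ) : ℂ) * Complex.I) =
      Complex.exp (2 * Real.pi * Complex.I * ((-m : ℤ) : ℂ) / ((2 * M : ℕ) : ℂ) * ((j : ℕ) : ℂ)) := by
    intro j
    congr 1
    push_cast
    ring
  simp_rw [hterm]
  rw [Fin.sum_univ_eq_sum_range (fun j => Complex.exp (2 * Real.pi * Complex.I * ((-m : ℤ) : ℂ) / ((2 * M : ℕ) : ℂ) * (j : ℂ))) (2 * M)]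
  by_cases hdiv : ((2 * M : ℕ) : ℤ) ∣ m
  · rw [if_pos hdiv]
    obtain ⟨q, hq⟩ := hdiv
    have h1 : ∀ j ∈ range (2 * M), Complex.exp (2 * Real.pi * Complex.I * ((-m : ℤ) : ℂ) / ((2 * M : ℕ) : ℂ) * (j : ℂ)) = 1 := by
      intro j _
      have hM' : ((2 * M : ℕ) : ℂ) ≠ 0 := by exact_mod_cast hMpos.ne'
      have hMc : (M : ℂ) ≠ 0 := by exact_mod_cast NeZero.ne M
      have hexp : (2 * Real.pi * Complex.I * ((-m : ℤ) : ℂ) / ((2 * M : ℕ) : ℂ) * (j : ℂ)) = ((-(q * j) : ℤ) : ℂ) * (2 * Real.pi * Complex.I) := by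
        rw [hq]; push_cast; field_simp
      rw [hexp]
      exact Complex.exp_int_mul_two_pi_mul_I _
    rw [sum_congr rfl h1, sum_const, card_range]
    simp
  · rw [if_neg hdiv]
    exact sum_range_cexp_two_pi_mul hMpos (fun h => hdiv (Int.dvd_neg.mp h))

/-! ## §2 The signed four-wave sum of the vertex pattern -/

/-- The signed spatial four-character sum: `Σ_z χ̄_{a}(z)χ_{b}(z)χ̄_{c}(z)χ_{d}(z) = L²·[a + c = b + d]`. -/
theorem klbv_sum_fourChar (a b c d : TorusSite 2 L) :
    ∑ z : TorusSite 2 L, conj (torusChar a z) * torusChar b z * conj (torusChar c z) * torusChar d z =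
      if a + c = b + d then ((L : ℂ) ^ 2) else 0 := by
  have hre : ∀ z : TorusSite 2 L, conj (torusChar a z) * torusChar b z * conj (torusChar c z) * torusChar d z = torusChar ((b + d) - (a + c)) z := by
    intro z
    rw [torusChar_sub_left, torusChar_comm (b + d) z, torusChar_add_right, torusChar_comm (a + c) z, torusChar_add_right, map_mul,
      torusChar_comm z b, torusChar_comm z d, torusChar_comm z a, torusChar_comm z c]
    ring
  simp_rw [hre]
  rw [sum_torusChar_right]
  by_cases h : a + c = b + d
  · rw [if_pos (sub_eq_zero.mpr h.symm), if_pos h]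
  · rw [if_neg (fun h' => h (sub_eq_zero.mp h').symm), if_neg h]

/-- **The signed four-wave sum at one space-time point** (`β ≠ 0`): for the vertex pattern's charges `(+,−,+,−)`,
`Σ_y ∏_i e^{−is_iκ_i·y} = |Λ|·[2M ∣ (n₀−n₁+n₂−n₃) ∧ k⃗₀ + k⃗₂ = k⃗₁ + k⃗₃]` (`n_i = matsubaraInt κ_i`, `|Λ| = 2M·L²`). -/
theorem klbv_sum_prod_planeWave_vertexPattern {β : ℝ} (hβ : β ≠ 0) (κ : Fin 4 → FreqMomentum L M) :
    ∑ y : SpaceTimeIdx L M, ∏ i : Fin 4, hubbardPlaneWave L M β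
        ((![(((0 : Fin 1), (0 : Fin 2)), (0 : Fin 2)), ((0, 0), 1), ((0, 1), 0), ((0, 1), 1)] : Fin 4 → SectorLeg 1) i).2 (κ i) y =
      if ((2 * M : ℕ) : ℤ) ∣ (matsubaraInt M (κ 0).1 - matsubaraInt M (κ 1).1 + matsubaraInt M (κ 2).1 - matsubaraInt M (κ 3).1) ∧
          (κ 0).2 + (κ 2).2 = (κ 1).2 + (κ 3).2 then (Fintype.card (SpaceTimeIdx L M) : ℂ) else 0 := by
  -- factorise each plane wave and the product into time × space
  have hprod : ∀ y : SpaceTimeIdx L M, (∏ i : Fin 4, hubbardPlaneWave L M β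
        ((![(((0 : Fin 1), (0 : Fin 2)), (0 : Fin 2)), ((0, 0), 1), ((0, 1), 0), ((0, 1), 1)] : Fin 4 → SectorLeg 1) i).2 (κ i) y) =
      Complex.exp (-((2 * Real.pi * ((matsubaraInt M (κ 0).1 - matsubaraInt M (κ 1).1 + matsubaraInt M (κ 2).1 - matsubaraInt M (κ 3).1 : ℤ) : ℝ) *
          ((y.1 : ℕ) : ℝ) / (2 * M) : ℝ) : ℂ) * Complex.I) *
        (conj (torusChar (κ 0).2 y.2) * torusChar (κ 1).2 y.2 * conj (torusChar (κ 2).2 y.2) * torusChar (κ 3).2 y.2) := by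
    intro y
    rw [Fin.prod_univ_four]
    simp only [Matrix.cons_val_zero, Matrix.cons_val_one, Matrix.cons_val, hubbardPlaneWave_eq, chargeSign, if_true,
      show (1 : Fin 2) ≠ 0 by decide, if_false]
    have hM : (M : ℝ) ≠ 0 := by exact_mod_cast NeZero.ne M
    have hexp : ∀ (a b c d : ℝ),
        Complex.exp (-((a : ℝ) : ℂ) * Complex.I) * Complex.exp (-((b : ℝ) : ℂ) * Complex.I) * Complex.exp (-((c : ℝ) : ℂ) * Complex.I) *
            Complex.exp (-((d : ℝ) : ℂ) * Complex.I) = Complex.exp (-(((a + b + c + d : ℝ) : ℝ) : ℂ) * Complex.I) := by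
      intro a b c d
      rw [← Complex.exp_add, ← Complex.exp_add, ← Complex.exp_add]
      congr 1; push_cast; ring
    have htime : 1 * (matsubaraFreq β M (κ 0).1 * imagTime β M y.1) + -1 * (matsubaraFreq β M (κ 1).1 * imagTime β M y.1) +
          1 * (matsubaraFreq β M (κ 2).1 * imagTime β M y.1) + -1 * (matsubaraFreq β M (κ 3).1 * imagTime β M y.1) =
        2 * Real.pi * ((matsubaraInt M (κ 0).1 - matsubaraInt M (κ 1).1 + matsubaraInt M (κ 2).1 - matsubaraInt M (κ 3).1 : ℤ) : ℝ) *
          ((y.1 : ℕ) : ℝ) / (2 * M) := by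
      simp only [matsubaraFreq, imagTime]
      push_cast
      field_simp
      ring
    calc _ = (Complex.exp (-((1 * (matsubaraFreq β M (κ 0).1 * imagTime β M y.1) : ℝ) : ℂ) * Complex.I) *
              Complex.exp (-((-1 * (matsubaraFreq β M (κ 1).1 * imagTime β M y.1) : ℝ) : ℂ) * Complex.I) *
              Complex.exp (-((1 * (matsubaraFreq β M (κ 2).1 * imagTime β M y.1) : ℝ) : ℂ) * Complex.I) *
              Complex.exp (-((-1 * (matsubaraFreq β M (κ 3).1 * imagTime β M y.1) : ℝ) : ℂ) * Complex.I)) *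
            (conj (torusChar (κ 0).2 y.2) * torusChar (κ 1).2 y.2 * conj (torusChar (κ 2).2 y.2) * torusChar (κ 3).2 y.2) := by ring
      _ = _ := by rw [hexp, htime]
  simp_rw [hprod]
  rw [Fintype.sum_prod_type]
  dsimp only
  rw [← sum_mul_sum, klbv_sum_cexp_two_pi_int, klbv_sum_fourChar]
  by_cases h1 : ((2 * M : ℕ) : ℤ) ∣ (matsubaraInt M (κ 0).1 - matsubaraInt M (κ 1).1 + matsubaraInt M (κ 2).1 - matsubaraInt M (κ 3).1)
  · by_cases h2 : (κ 0).2 + (κ 2).2 = (κ 1).2 + (κ 3).2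
    · rw [if_pos h1, if_pos h2, if_pos ⟨h1, h2⟩, Fintype.card_prod, Fintype.card_fin, Fintype.card_pi, Fin.prod_const, ZMod.card]
      push_cast; ring
    · rw [if_neg h2, mul_zero, if_neg (fun h => h2 h.2)]
  · rw [if_neg h1, zero_mul, if_neg (fun h => h1 h.1)]

/-! ## §3 The local vertex as a momentum sum; the umklapp difference; equality of kernels away from the edge -/

/-- **The time-lattice-local vertex as a momentum sum of vertex monomials** (`β ≠ 0`):
`hubbardInteractionLocal = Σ_κ [2M ∣ (n₀−n₁+n₂−n₃) ∧ k⃗₀+k⃗₂ = k⃗₁+k⃗₃]·U(βL²)⁻³ • vertexMonomial κ` — MODULAR conservation, versus the INTEGER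
conservation `vertexConserving` of `hubbardInteraction_eq_sum_smul`. -/
theorem klbv_hubbardInteractionLocal_eq_sum_smul {β : ℝ} (hβ : β ≠ 0) (U : ℝ) :
    hubbardInteractionLocal L M β U = ∑ κ : Fin 4 → FreqMomentum L M,
      (if ((2 * M : ℕ) : ℤ) ∣ (matsubaraInt M (κ 0).1 - matsubaraInt M (κ 1).1 + matsubaraInt M (κ 2).1 - matsubaraInt M (κ 3).1) ∧
          (κ 0).2 + (κ 2).2 = (κ 1).2 + (κ 3).2 then (((U / (β * (L : ℝ) ^ 2) ^ 3 : ℝ)) : ℂ) else 0) • vertexMonomial L M κ := by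
  have hL : (L : ℝ) ≠ 0 := by exact_mod_cast NeZero.ne L
  have hM : (M : ℝ) ≠ 0 := by exact_mod_cast NeZero.ne M
  unfold hubbardInteractionLocal
  simp_rw [klbv_psiPos_word_eq_sum]
  rw [sum_comm, smul_sum]
  refine sum_congr rfl fun κ _ => ?_
  rw [← sum_smul, smul_smul]
  congr 1
  -- the coefficient: `(Uε)·Σ_y ∏_i (βL²)⁻¹ conj(e^{−is_iκ_i·y}) = [modular conservation]·U(βL²)⁻³`
  have hfac : ∀ y : SpaceTimeIdx L M,
      (∏ i : Fin 4, (((1 / (β * (L : ℝ) ^ 2) : ℝ) : ℂ) * conj (hubbardPlaneWave L M β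
        ((![(((0 : Fin 1), (0 : Fin 2)), (0 : Fin 2)), ((0, 0), 1), ((0, 1), 0), ((0, 1), 1)] : Fin 4 → SectorLeg 1) i).2 (κ i) y))) =
      ((1 / (β * (L : ℝ) ^ 2) : ℝ) : ℂ) ^ 4 * conj (∏ i : Fin 4, hubbardPlaneWave L M β
        ((![(((0 : Fin 1), (0 : Fin 2)), (0 : Fin 2)), ((0, 0), 1), ((0, 1), 0), ((0, 1), 1)] : Fin 4 → SectorLeg 1) i).2 (κ i) y) := by
    intro y
    rw [prod_mul_distrib, prod_const, card_univ, Fintype.card_fin, map_prod]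
  simp_rw [hfac]
  rw [← mul_sum, ← map_sum, klbv_sum_prod_planeWave_vertexPattern hβ]
  have hMc : (M : ℂ) ≠ 0 := by exact_mod_cast NeZero.ne M
  split_ifs with h
  · rw [Complex.conj_natCast, Fintype.card_prod, Fintype.card_fin, Fintype.card_pi, Fin.prod_const, ZMod.card, imagTimeWeight]
    push_cast
    field_simp
  · rw [map_zero, mul_zero, mul_zero]

/-- **The umklapp difference**: `V_loc − V = Σ_κ [modular ∧ ¬ integer conservation]·U(βL²)⁻³ • vertexMonomial κ` — exactly the frequency wrap-around monomials
(`n₀ − n₁ + n₂ − n₃ = ±2M`) that the tree's `hubbardInteraction` omits. -/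
theorem klbv_hubbardInteractionLocal_sub_hubbardInteraction {β : ℝ} (hβ : β ≠ 0) (U : ℝ) :
    hubbardInteractionLocal L M β U - hubbardInteraction L M β U = ∑ κ : Fin 4 → FreqMomentum L M,
      (if (((2 * M : ℕ) : ℤ) ∣ (matsubaraInt M (κ 0).1 - matsubaraInt M (κ 1).1 + matsubaraInt M (κ 2).1 - matsubaraInt M (κ 3).1) ∧
          (κ 0).2 + (κ 2).2 = (κ 1).2 + (κ 3).2) ∧ ¬ vertexConserving L M κ then (((U / (β * (L : ℝ) ^ 2) ^ 3 : ℝ)) : ℂ) else 0) •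
        vertexMonomial L M κ := by
  rw [klbv_hubbardInteractionLocal_eq_sum_smul hβ, hubbardInteraction_eq_sum_smul, ← sum_sub_distrib]
  refine sum_congr rfl fun κ _ => ?_
  rw [← sub_smul]
  congr 1
  by_cases hv : vertexConserving L M κ
  · -- integer conservation implies modular conservation
    have hmod : ((2 * M : ℕ) : ℤ) ∣ (matsubaraInt M (κ 0).1 - matsubaraInt M (κ 1).1 + matsubaraInt M (κ 2).1 - matsubaraInt M (κ 3).1) ∧
        (κ 0).2 + (κ 2).2 = (κ 1).2 + (κ 3).2 := by
      refine ⟨?_, hv.2⟩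
      have h0 : matsubaraInt M (κ 0).1 - matsubaraInt M (κ 1).1 + matsubaraInt M (κ 2).1 - matsubaraInt M (κ 3).1 = 0 := by
        have := hv.1; omega
      rw [h0]; exact dvd_zero _
    rw [if_pos hmod, if_pos hv, if_neg (fun h => h.2 hv), sub_self]
  · rw [if_neg hv, sub_zero]
    by_cases hmod : ((2 * M : ℕ) : ℤ) ∣ (matsubaraInt M (κ 0).1 - matsubaraInt M (κ 1).1 + matsubaraInt M (κ 2).1 - matsubaraInt M (κ 3).1) ∧
        (κ 0).2 + (κ 2).2 = (κ 1).2 + (κ 3).2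
    · rw [if_pos hmod, if_pos ⟨hmod, hv⟩]
    · rw [if_neg hmod, if_neg (fun h => hmod h.1)]

omit [NeZero M] in
/-- The quartic kernel of a linear combination of vertex monomials at `vertexLegs k` is its `k`-th coefficient times `(4!)⁻¹`. -/
theorem klbv_kernel_sum_smul_vertexMonomial_vertexLegs (c : (Fin 4 → FreqMomentum L M) → ℂ) (k : Fin 4 → FreqMomentum L M) :
    kernel ℂ (∑ κ : Fin 4 → FreqMomentum L M, c κ • vertexMonomial L M κ) 4 (vertexLegs L M k) = c k * (((4 : ℕ).factorial : ℚ)⁻¹ • (1 : ℂ)) := by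
  rw [kernel_sum]
  simp_rw [kernel_smul, vertexMonomial_eq_genProd, kernel_genProd, det_deltaMatrix_vertexLegs]
  simp_rw [mul_ite, mul_one, mul_zero]
  rw [sum_ite_eq univ k, if_pos (mem_univ k)]

/-- **Away from the Matsubara edge the two vertices have the same quartic kernels**: if `|n₀|+|n₁|+|n₂|+|n₃| < 2M` then
`kernel V_loc 4 (vertexLegs k) = kernel V 4 (vertexLegs k)` — every UV-cut (sectorised, point) row reads the same numbers for `V_loc` and `V`. -/
theorem klbv_kernel_vertexLegs_local_eq_of_small {β : ℝ} (hβ : β ≠ 0) (U : ℝ) (k : Fin 4 → FreqMomentum L M)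
    (hsmall : |matsubaraInt M (k 0).1| + |matsubaraInt M (k 1).1| + |matsubaraInt M (k 2).1| + |matsubaraInt M (k 3).1| < ((2 * M : ℕ) : ℤ)) :
    kernel ℂ (hubbardInteractionLocal L M β U) 4 (vertexLegs L M k) = kernel ℂ (hubbardInteraction L M β U) 4 (vertexLegs L M k) := by
  rw [klbv_hubbardInteractionLocal_eq_sum_smul hβ, hubbardInteraction_eq_sum_smul, klbv_kernel_sum_smul_vertexMonomial_vertexLegs,
    klbv_kernel_sum_smul_vertexMonomial_vertexLegs]
  congr 1
  have hiff : (((2 * M : ℕ) : ℤ) ∣ (matsubaraInt M (k 0).1 - matsubaraInt M (k 1).1 + matsubaraInt M (k 2).1 - matsubaraInt M (k 3).1) ∧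
      (k 0).2 + (k 2).2 = (k 1).2 + (k 3).2) ↔ vertexConserving L M k := by
    unfold vertexConserving
    constructor
    · rintro ⟨⟨q, hq⟩, h2⟩
      refine ⟨?_, h2⟩
      -- `|m| < 2M` and `2M ∣ m` force `m = 0`
      have habs : |matsubaraInt M (k 0).1 - matsubaraInt M (k 1).1 + matsubaraInt M (k 2).1 - matsubaraInt M (k 3).1| < ((2 * M : ℕ) : ℤ) := by
        have h0 := le_abs_self (matsubaraInt M (k 0).1); have h0' := neg_abs_le (matsubaraInt M (k 0).1)
        have h1 := le_abs_self (matsubaraInt M (k 1).1); have h1' := neg_abs_le (matsubaraInt M (k 1).1)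
        have h2 := le_abs_self (matsubaraInt M (k 2).1); have h2' := neg_abs_le (matsubaraInt M (k 2).1)
        have h3 := le_abs_self (matsubaraInt M (k 3).1); have h3' := neg_abs_le (matsubaraInt M (k 3).1)
        rw [abs_lt]; constructor <;> linarith
      rw [hq, abs_mul, Nat.abs_cast] at habs
      have hq0 : q = 0 := by
        by_contra hne
        have h1 : (1 : ℤ) ≤ |q| := Int.one_le_abs hne
        have hpos : (0 : ℤ) < ((2 * M : ℕ) : ℤ) := by have := NeZero.ne M; positivity
        nlinarith
      rw [hq0, mul_zero] at hq
      omega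
    · rintro ⟨h1, h2⟩
      refine ⟨?_, h2⟩
      have h0 : matsubaraInt M (k 0).1 - matsubaraInt M (k 1).1 + matsubaraInt M (k 2).1 - matsubaraInt M (k 3).1 = 0 := by omega
      rw [h0]; exact dvd_zero _
  by_cases hv : vertexConserving L M k
  · rw [if_pos (hiff.mpr hv), if_pos hv]
  · rw [if_neg (fun h => hv (hiff.mp h)), if_neg hv]

end Summit.HubbardSuperconductivity.HubbardSuperconductivity.Theorems.KLRegimeSplit

end
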